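import Mathlib
import Literature.Computability.AlgebraicComplexity.PermanentUniversality
import Literature.Computability.AlgebraicComplexity.PermanentBooleanSum
import Literature.Computability.AlgebraicComplexity.ReadKDeterminantalRepresentations

/-!
# Read-once universality of the permanent (Hrubeš–Joglekar 2025, Theorem 3)

Topic `Computability/AlgebraicComplexity`. Second proof file behind
`Literature.Computability.AlgebraicComplexity.HrubesJoglekar2025_variableSize_perPoly`
(Hrubeš–Joglekar 2025, Thm. 7). It proves the "permanent side" of the printed proof, §3 of the
paper:

**Theorem 3 (Hrubeš–Joglekar 2025).** Let `𝔽` have characteristic `≠ 2` and let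
`f ∈ 𝔽[x_1, …, x_n]` be multilinear. Then there is `m ≤ O(2^n)` and a matrix `M` over
`𝔽 ∪ {x_1, …, x_n}` with `f = perm_m(M)` in which each `x_i` appears exactly once; moreover every
row and column of `M` contains at most one variable.

We follow the printed proof literally, on top of the tree's formalisation of Valiant's
`VNP`-completeness of the permanent (BCS 1997, Thms. (21.27), (21.29) =
`PermanentUniversality.lean`, `PermanentBooleanSum.lean`, which are Lemmas 4 and 5 of the paper):

1. (`rookExpr`, proof of Thm. 3 and Lemma 6) the formula
   `g = f̂(y) · ∏_i (x_i y_i + (1 - y_i))`, `f̂(y) = ∑_S a_S ∏_{i∈S} y_i ∏_{i∉S} (1 - y_i)` written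
   as a decision tree of size `O(2^n)` (`dtree`, Lemma 6), in which each `x_i` occurs exactly once;
   its Boolean sum over `y` is `f` (`boolSum_rookExpr`).
2. (Lemma 4 = BCS (21.27)) `g = per μ(g)` for the lower Hessenberg matrix `ArithExpr.toMatrix g`
   of the tree, which has the column property; we add the bookkeeping of WHERE the `x_i` sit in
   `μ(g)`: exactly once each, in pairwise distinct diagonal cells (`toMatrix_rookExpr_eq_X_iff`,
   via the `X`-specification `XSpec` of the weighted DAGs `leafW/seriesW/parallelW`).
3. (Lemma 5 = BCS (21.29)) the Boolean sum is eliminated one variable at a time by the Valiant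
   gadgets of `PermanentBooleanSum.lean`; we re-run that file's induction `elim_boolSum` with the
   extra invariant `IsXRook` ("every `x_i` exactly once, `X`-cells in distinct rows and columns"),
   which the gadget preserves because, under the column property, the columns it duplicates carry
   no `x`-variable (`IsXRook.gadget`). Result: `exists_isXRook_entryPer`, size `≤ 256 · 2^κ`.
4. (`exists_rook_symbMatrix`, the form used in the proof of Thm. 7 with its footnote 3) pad by an
   identity block to any `n ≥ 256 · 2^κ` and permute rows and columns
   (`Equiv.Perm.exists_extending_pair`) so that `x_l` sits in any prescribed cells
   `(ρr l, ρc l)` with distinct rows and distinct columns: a symbolic `n × n` matrix `S` over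
   `X ∪ k` (the convention `Sum.inl = variable` of `symbPoly`) with `per (symbPoly S) = f`.

## Main statements

* `boolSum_rookExpr`, `toMatrix_rookExpr_eq_X_iff`, `elim_boolSum_rook`,
  `exists_isXRook_entryPer` (Thm. 3), `exists_rook_symbMatrix` (Thm. 3 as used in Thm. 7).

## References

* P. Hrubeš, P. S. Joglekar, *On read-k projections of the determinant*, STACS 2025,
  LIPIcs 327, 53:1–53:7, §3 (Thm. 3, Lemmas 4–6) and the proof of Thm. 7 (p. 6).
* P. Bürgisser, M. Clausen, M. A. Shokrollahi, *Algebraic Complexity Theory*, Springer 1997,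
  Thms. (21.27), (21.29).
-/

open MvPolynomial Matrix Finset

namespace Literature.Computability.AlgebraicComplexity

universe u v

section Expr

variable {k : Type u} [CommRing k] {σ : Type v} {t : ℕ}

open ArithExpr

/-- The literal `Y_j` (`b = true`) or `1 - Y_j = 1 + (-1)·Y_j` (`b = false`) as an arithmetic expression
(the factors `y_i`, `1 - y_i` of `f̂` in Hrubeš–Joglekar 2025, proof of Thm. 3). [cite: HrubesJoglekar2025, Lemma 6 and proof of Thm. 3 (p. 5)] -/
def litY (j : Fin t) : Bool → ArithExpr k (σ ⊕ Fin t)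
  | true => var (Sum.inr j)
  | false => add (const 1) (mul (const (-1)) (var (Sum.inr j)))

/-- `E(Y_j) = 0`. [cite: HrubesJoglekar2025, Lemma 6 and proof of Thm. 3 (p. 5)] -/
@[simp] theorem size_litY_true (j : Fin t) : (litY (k := k) (σ := σ) j true).size = 0 := rfl
/-- `E(1 - Y_j) = 2`. [cite: HrubesJoglekar2025, Lemma 6 and proof of Thm. 3 (p. 5)] -/
@[simp] theorem size_litY_false (j : Fin t) : (litY (k := k) (σ := σ) j false).size = 2 := rfl

/-- `val(litY j b)` is `Y_j` resp. `1 - Y_j`. [cite: HrubesJoglekar2025, Lemma 6 and proof of Thm. 3 (p. 5)] -/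
theorem eval_litY (j : Fin t) (b : Bool) :
    (litY (k := k) (σ := σ) j b).eval = if b then X (Sum.inr j) else 1 - X (Sum.inr j) := by
  cases b <;> simp [litY, ArithExpr.eval]; ring

/-- The decision tree over `Y_0, …, Y_{d-1}` with leaf values `f : (Fin d → Bool) → k`:
`dtree 0 f = f()` and `dtree (d+1) f = Y_d · dtree d f(·,1) + (1 - Y_d) · dtree d f(·,0)` — the formula of
size `O(2^d)` for `f̂(y) = ∑_S a_S ∏_{i∈S} y_i ∏_{i∉S} (1-y_i)` (Hrubeš–Joglekar 2025, Lemma 6: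
`f = x_n f_1 + f_0`, size `≤ 2s + 2`; here with the literal `1 - Y_d` in place of a free
second branch, which is what the proof of Thm. 3 needs). [cite: HrubesJoglekar2025, Lemma 6 and proof of Thm. 3 (p. 5)] -/
def dtree : (d : ℕ) → d ≤ t → ((Fin d → Bool) → k) → ArithExpr k (σ ⊕ Fin t)
  | 0, _, f => const (f Fin.elim0)
  | d + 1, hd, f =>
      add (mul (litY ⟨d, hd⟩ true) (dtree d (Nat.le_of_succ_le hd) fun e => f (Fin.snoc e true)))
        (mul (litY ⟨d, hd⟩ false) (dtree d (Nat.le_of_succ_le hd) fun e => f (Fin.snoc e false)))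

/-- The decision tree over `d` variables has size `5 (2^d - 1)` (Hrubeš–Joglekar 2025, Lemma 6:
`O(2^n)`). [cite: HrubesJoglekar2025, Lemma 6 and proof of Thm. 3 (p. 5)] -/
theorem size_dtree : ∀ (d : ℕ) (hd : d ≤ t) (f : (Fin d → Bool) → k),
    (dtree (σ := σ) d hd f).size = 5 * (2 ^ d - 1)
  | 0, _, _ => rfl
  | d + 1, hd, f => by
    simp only [dtree, ArithExpr.size_add, ArithExpr.size_mul, size_litY_true, size_litY_false,
      size_dtree d]
    have := Nat.one_le_two_pow (n := d)
    rw [pow_succ]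
    omega

/-- The Boolean substitution `X_i ↦ X_i`, `Y_j ↦ e_j ∈ {0,1}` (the summand of `boolSum` at `e`).
[cite: HrubesJoglekar2025, Lemma 6 and proof of Thm. 3 (p. 5)] -/
noncomputable abbrev bsub (k : Type u) [CommRing k] (e : Fin t → Bool) : σ ⊕ Fin t → MvPolynomial σ k :=
  Sum.elim X fun j => if e j then 1 else 0

/-- Under `Y ↦ e`, the literal `litY j b` becomes the indicator `[e_j = b]`. [cite: HrubesJoglekar2025, Lemma 6 and proof of Thm. 3 (p. 5)] -/
theorem aeval_bsub_litY (e : Fin t → Bool) (j : Fin t) (b : Bool) :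
    aeval (bsub k e) (litY (k := k) (σ := σ) j b).eval = if e j = b then 1 else 0 := by
  rw [eval_litY]
  cases b <;> cases h : e j <;> simp [h]

/-- Under `Y ↦ e`, the decision tree evaluates to its leaf at `e`: `f̂(e) = a_{S(e)}`
(Hrubeš–Joglekar 2025, proof of Thm. 3: "for any boolean substitution … `f̂(y_1,…,y_n) = a_S`
where `S = {i | y_i = 1}`"). [cite: HrubesJoglekar2025, Lemma 6 and proof of Thm. 3 (p. 5)] -/
theorem aeval_bsub_dtree (e : Fin t → Bool) : ∀ (d : ℕ) (hd : d ≤ t) (f : (Fin d → Bool) → k),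
    aeval (bsub k e) (dtree (σ := σ) d hd f).eval = C (f fun i => e (Fin.castLE hd i))
  | 0, _, f => by
    simp only [dtree, ArithExpr.eval_const, aeval_C]
    congr 2
    exact Subsingleton.elim _ _
  | d + 1, hd, f => by
    simp only [dtree, ArithExpr.eval_add, ArithExpr.eval_mul, map_add, map_mul, aeval_bsub_litY,
      aeval_bsub_dtree e d]
    have key : ∀ b : Bool, (Fin.snoc (fun i => e (Fin.castLE (Nat.le_of_succ_le hd) i)) b :
        Fin (d + 1) → Bool) = (fun i => e (Fin.castLE hd i)) ↔ e ⟨d, hd⟩ = b := by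
      intro b
      have hc : Fin.castLE hd (Fin.last d) = ⟨d, hd⟩ := rfl
      constructor
      · intro h
        have := congrFun h (Fin.last d)
        rw [Fin.snoc_last, hc] at this
        exact this.symm
      · intro h
        funext i
        refine Fin.lastCases ?_ (fun i => ?_) i
        · rw [Fin.snoc_last, hc, h]
        · rw [Fin.snoc_castSucc]
          rfl
    cases h : e ⟨d, hd⟩
    · have h1 := (key false).2 h
      rw [← h1]
      simp
    · have h1 := (key true).2 h
      rw [← h1]
      simp

/-- The read-once factor `X_l · Y_j + (1 - Y_j)` of Hrubeš–Joglekar 2025, proof of Thm. 3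
(`x_i y_i + (1 - y_i)`, in which `x_i` appears exactly once). [cite: HrubesJoglekar2025, Thm. 3 (pp. 4–5)] -/
def factorXY (l : σ) (j : Fin t) : ArithExpr k (σ ⊕ Fin t) :=
  add (mul (var (Sum.inl l)) (var (Sum.inr j))) (litY j false)

/-- `E(X_l Y_j + (1 - Y_j)) = 4`. [cite: HrubesJoglekar2025, Thm. 3 (pp. 4–5)] -/
@[simp] theorem size_factorXY (l : σ) (j : Fin t) : (factorXY (k := k) l j).size = 4 := rfl

/-- Under `Y ↦ e` the factor becomes `X_l` if `e_j = 1` and `1` otherwise. [cite: HrubesJoglekar2025, Thm. 3 (pp. 4–5)] -/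
theorem aeval_bsub_factorXY (e : Fin t → Bool) (l : σ) (j : Fin t) :
    aeval (bsub k e) (factorXY (k := k) l j).eval = if e j then X l else 1 := by
  simp only [factorXY, ArithExpr.eval_add, ArithExpr.eval_mul, ArithExpr.eval_var, map_add, map_mul,
    aeval_X, aeval_bsub_litY]
  cases h : e j <;> simp [bsub, h]

end Expr

section ExprFin

variable {k : Type u} [CommRing k] {κ : ℕ}

/-- The read-once product `∏_{l < d} (X_l Y_l + (1 - Y_l))` (Hrubeš–Joglekar 2025, proof of Thm. 3:
`∏_i (x_i y_i + (1 - y_i))`, "each `x_i` appears exactly once"). [cite: HrubesJoglekar2025, Thm. 3 (pp. 4–5)] -/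
def prodXY : (d : ℕ) → d ≤ κ → ArithExpr k (Fin κ ⊕ Fin κ)
  | 0, _ => ArithExpr.const 1
  | d + 1, hd => ArithExpr.mul (prodXY d (Nat.le_of_succ_le hd)) (factorXY ⟨d, hd⟩ ⟨d, hd⟩)

/-- `E(∏_{l<d} (X_l Y_l + 1 - Y_l)) = 5d`. [cite: HrubesJoglekar2025, Thm. 3 (pp. 4–5)] -/
theorem size_prodXY : ∀ (d : ℕ) (hd : d ≤ κ), (prodXY (k := k) d hd).size = 5 * d
  | 0, _ => rfl
  | d + 1, hd => by
    simp only [prodXY, ArithExpr.size_mul, size_prodXY d, size_factorXY]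
    ring

/-- Under `Y ↦ e` the product becomes the monomial `∏_{e_l = 1} X_l`. [cite: HrubesJoglekar2025, Thm. 3 (pp. 4–5)] -/
theorem aeval_bsub_prodXY (e : Fin κ → Bool) : ∀ (d : ℕ) (hd : d ≤ κ),
    aeval (bsub k e) (prodXY (k := k) d hd).eval =
      ∏ i : Fin d, if e (Fin.castLE hd i) then X (Fin.castLE hd i) else 1
  | 0, _ => by simp [prodXY]
  | d + 1, hd => by
    rw [prodXY, ArithExpr.eval_mul, map_mul, aeval_bsub_prodXY e d, aeval_bsub_factorXY,
      Fin.prod_univ_castSucc]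
    rfl

/-- The expression `g = f̂(Y) · ∏_l (X_l Y_l + (1 - Y_l))` of Hrubeš–Joglekar 2025, proof of
Thm. 3, for the multilinear polynomial with coefficient vector `a : (Fin κ → Bool) → k`; its
Boolean sum over `Y` is that polynomial (`boolSum_rookExpr`) and each `X_l` occurs in it exactly
once. [cite: HrubesJoglekar2025, Thm. 3 (pp. 4–5)] -/
def rookExpr (a : (Fin κ → Bool) → k) : ArithExpr k (Fin κ ⊕ Fin κ) :=
  ArithExpr.mul (dtree κ le_rfl a) (prodXY κ le_rfl)

/-- `E(g) = 5(2^κ - 1) + 5κ + 1 = O(2^κ)` (Hrubeš–Joglekar 2025, proof of Thm. 3: "`g` has a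
formula of size `O(2^n)` in which each variable from `X` appears exactly once"). [cite: HrubesJoglekar2025, Thm. 3 (pp. 4–5)] -/
theorem size_rookExpr (a : (Fin κ → Bool) → k) : (rookExpr a).size = 5 * (2 ^ κ - 1) + 5 * κ + 1 := by
  simp [rookExpr, size_dtree, size_prodXY]

/-- The summand of the Boolean sum of `g` at `e` is `a_e · ∏_{e_l=1} X_l`. [cite: HrubesJoglekar2025, Thm. 3 (pp. 4–5)] -/
theorem aeval_bsub_rookExpr (a : (Fin κ → Bool) → k) (e : Fin κ → Bool) :
    aeval (bsub k e) (rookExpr a).eval = C (a e) * ∏ i : Fin κ, if e i then X i else 1 := by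
  rw [rookExpr, ArithExpr.eval_mul, map_mul, aeval_bsub_dtree, aeval_bsub_prodXY]
  simp

/-- **`f = ∑_{y ∈ {0,1}^n} f̂(y) ∏_i (x_i y_i + (1 - y_i))`** (Hrubeš–Joglekar 2025, proof of Thm. 3):
the Boolean sum of `rookExpr a` is the multilinear polynomial `∑_e a_e ∏_{e_l = 1} X_l`. [cite: HrubesJoglekar2025, Thm. 3 (pp. 4–5)] -/
theorem boolSum_rookExpr (a : (Fin κ → Bool) → k) :
    boolSum (rookExpr a).eval = ∑ e : Fin κ → Bool, C (a e) * ∏ i : Fin κ, if e i then X i else 1 := by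
  unfold boolSum
  exact Finset.sum_congr rfl fun e _ => aeval_bsub_rookExpr a e

end ExprFin

section XStructure

variable {k : Type u} {σ : Type v} {t : ℕ}

/-- No edge of the weighted DAG `W` carries an `X`-variable. [cite: BurgisserClausenShokrollahi1997, Thm. (21.27) (D)] -/
def NoX (W : ℕ → ℕ → k ⊕ (σ ⊕ Fin t)) : Prop :=
  ∀ a b l, W a b ≠ Sum.inr (Sum.inl l)

/-- `XSpec W S pos`: the edges of the weighted DAG `W` carrying an `X`-variable are exactly the
edges `pos l → pos l + 1` labelled `X_l`, for `l ∈ S` (bookkeeping of where the read-once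
variables sit in the construction of BCS 1997, Thm. (21.27)). [cite: BurgisserClausenShokrollahi1997, Thm. (21.27) (D)] -/
def XSpec (W : ℕ → ℕ → k ⊕ (σ ⊕ Fin t)) (S : Set σ) (pos : σ → ℕ) : Prop :=
  ∀ a b l, W a b = Sum.inr (Sum.inl l) ↔ (l ∈ S ∧ a = pos l ∧ b = pos l + 1)

variable [CommSemiring k]

/-- A leaf which is not an `X`-variable has no `X`-edge. [cite: BurgisserClausenShokrollahi1997, Thm. (21.27) (D)] -/
theorem noX_leafW (ℓ : k ⊕ (σ ⊕ Fin t)) (hℓ : ∀ l, ℓ ≠ Sum.inr (Sum.inl l)) : NoX (leafW ℓ) := by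
  intro a b l
  simp only [leafW]
  split_ifs with h1 h2
  · exact hℓ l
  · simp
  · simp

/-- Series composition of `X`-free DAGs is `X`-free. [cite: BurgisserClausenShokrollahi1997, Thm. (21.27) (D)] -/
theorem noX_seriesW {n₁ : ℕ} {W₁ W₂ : ℕ → ℕ → k ⊕ (σ ⊕ Fin t)} (h₁ : NoX W₁) (h₂ : NoX W₂) :
    NoX (seriesW n₁ W₁ W₂) := by
  intro a b l
  simp only [seriesW]
  split_ifs with hb ha
  · exact h₁ a b l
  · exact h₂ _ _ l
  · simp

/-- Parallel composition of `X`-free DAGs is `X`-free (the bridge is the constant `1`). [cite: BurgisserClausenShokrollahi1997, Thm. (21.27) (D)] -/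
theorem noX_parallelW {n₁ n₂ : ℕ} {W₁ W₂ : ℕ → ℕ → k ⊕ (σ ⊕ Fin t)} (h₁ : NoX W₁) (h₂ : NoX W₂) :
    NoX (parallelW n₁ n₂ W₁ W₂) := by
  intro a b l
  simp only [parallelW]
  split_ifs with hb ha ha' hbr
  · exact h₁ a b l
  · exact h₂ _ _ l
  · exact h₂ _ _ l
  · simp
  · simp

omit [CommSemiring k] in
/-- An `X`-free DAG has the empty `X`-specification. [cite: BurgisserClausenShokrollahi1997, Thm. (21.27) (D)] -/
theorem xspec_of_noX {W : ℕ → ℕ → k ⊕ (σ ⊕ Fin t)} (h : NoX W) (pos : σ → ℕ) : XSpec W ∅ pos := by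
  intro a b l
  simp only [Set.mem_empty_iff_false, false_and, iff_false]
  exact h a b l

/-- The leaf `X_l` has the single `X`-edge `0 → 1`. [cite: BurgisserClausenShokrollahi1997, Thm. (21.27) (D)] -/
theorem xspec_leafW_X (l₀ : σ) :
    XSpec (leafW (Sum.inr (Sum.inl l₀) : k ⊕ (σ ⊕ Fin t))) {l₀} (fun _ => 0) := by
  intro a b l
  simp only [leafW, Set.mem_singleton_iff]
  split_ifs with h1 h2
  · simp only [Sum.inr.injEq, Sum.inl.injEq]
    constructor
    · rintro rfl; exact ⟨rfl, h1.1, h1.2⟩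
    · rintro ⟨rfl, -, -⟩; rfl
  · simp only [false_iff, not_and]
    rintro - rfl rfl
    exact h1 ⟨rfl, rfl⟩
  · simp only [false_iff, not_and]
    rintro - rfl rfl
    exact h1 ⟨rfl, rfl⟩

/-- Series composition of `X`-specifications: the second DAG is shifted by `n₁`
(`seriesW`), so its `X`-edges move by `n₁`. [cite: BurgisserClausenShokrollahi1997, Thm. (21.27) (D)] -/
theorem xspec_seriesW {n₁ : ℕ} {W₁ W₂ : ℕ → ℕ → k ⊕ (σ ⊕ Fin t)} {S₁ S₂ S : Set σ}
    {pos₁ pos₂ pos : σ → ℕ} (h₁ : XSpec W₁ S₁ pos₁) (h₂ : XSpec W₂ S₂ pos₂)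
    (hb : ∀ l ∈ S₁, pos₁ l + 1 ≤ n₁)
    (hS : ∀ l, l ∈ S ↔ l ∈ S₁ ∨ l ∈ S₂) (hp₁ : ∀ l ∈ S₁, pos l = pos₁ l)
    (hp₂ : ∀ l ∈ S₂, pos l = pos₂ l + n₁) :
    XSpec (seriesW n₁ W₁ W₂) S pos := by
  intro a b l
  simp only [seriesW]
  split_ifs with hbn ha
  · rw [h₁ a b l, hS]
    constructor
    · rintro ⟨hl, rfl, rfl⟩
      exact ⟨Or.inl hl, (hp₁ l hl).symm, by rw [hp₁ l hl]⟩
    · rintro ⟨hl | hl, rfl, rfl⟩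
      · exact ⟨hl, hp₁ l hl, by rw [hp₁ l hl]⟩
      · exfalso
        rw [hp₂ l hl] at hbn
        omega
  · rw [h₂ _ _ l, hS]
    constructor
    · rintro ⟨hl, ha', hb'⟩
      refine ⟨Or.inr hl, ?_, ?_⟩
      · rw [hp₂ l hl]; omega
      · rw [hp₂ l hl]; omega
    · rintro ⟨hl | hl, rfl, rfl⟩
      · exfalso
        have := hb l hl
        rw [hp₁ l hl] at hbn
        omega
      · refine ⟨hl, ?_, ?_⟩
        · rw [hp₂ l hl]; omega
        · rw [hp₂ l hl]; omega
  · simp only [false_iff, not_and]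
    rw [hS]
    rintro (hl | hl) rfl rfl
    · have := hb l hl
      rw [hp₁ l hl] at hbn
      omega
    · rw [hp₂ l hl] at ha
      omega

/-- Parallel composition with an `X`-free second part keeps the `X`-specification of the first
(whose `X`-edges have targets `≤ n₁`). [cite: BurgisserClausenShokrollahi1997, Thm. (21.27) (D)] -/
theorem xspec_parallelW_noX {n₁ n₂ : ℕ} {W₁ W₂ : ℕ → ℕ → k ⊕ (σ ⊕ Fin t)} {S : Set σ}
    {pos : σ → ℕ} (h₁ : XSpec W₁ S pos) (h₂ : NoX W₂) (hb : ∀ l ∈ S, pos l + 1 ≤ n₁) :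
    XSpec (parallelW n₁ n₂ W₁ W₂) S pos := by
  intro a b l
  simp only [parallelW]
  split_ifs with hbn ha ha' hbr
  · exact h₁ a b l
  · simp only [h₂ _ _ l, false_iff, not_and]
    rintro hl rfl rfl
    exact hbn (hb l hl)
  · simp only [h₂ _ _ l, false_iff, not_and]
    rintro hl rfl rfl
    exact hbn (hb l hl)
  · simp only [false_iff, not_and]
    rintro hl rfl rfl
    exact hbn (hb l hl)
  · simp only [false_iff, not_and]
    rintro hl rfl rfl
    exact hbn (hb l hl)

end XStructure

section ExprX

variable {k : Type u} [CommRing k] {σ : Type v} {t : ℕ}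

/-- The literals `Y_j`, `1 - Y_j` have `X`-free DAGs. [cite: HrubesJoglekar2025, Thm. 3 (pp. 4–5)] -/
theorem noX_dagWeights_litY (j : Fin t) (b : Bool) :
    NoX (litY (k := k) (σ := σ) j b).dagWeights := by
  cases b
  · exact noX_parallelW (noX_leafW _ (by simp))
      (noX_seriesW (noX_leafW _ (by simp)) (noX_leafW _ (by simp)))
  · exact noX_leafW _ (by simp)

/-- The decision tree has an `X`-free DAG. [cite: HrubesJoglekar2025, Thm. 3 (pp. 4–5)] -/
theorem noX_dagWeights_dtree : ∀ (d : ℕ) (hd : d ≤ t) (f : (Fin d → Bool) → k),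
    NoX (dtree (σ := σ) d hd f).dagWeights
  | 0, _, _ => noX_leafW _ (by simp)
  | d + 1, hd, f =>
    noX_parallelW (noX_seriesW (noX_dagWeights_litY _ _) (noX_dagWeights_dtree d _ _))
      (noX_seriesW (noX_dagWeights_litY _ _) (noX_dagWeights_dtree d _ _))

/-- In the DAG of `X_l Y_j + (1 - Y_j)` the only `X`-edge is `0 → 1`, labelled `X_l`. [cite: HrubesJoglekar2025, Thm. 3 (pp. 4–5)] -/
theorem xspec_dagWeights_factorXY (l : σ) (j : Fin t) :
    XSpec (factorXY (k := k) l j).dagWeights {l} (fun _ => 0) := by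
  refine xspec_parallelW_noX ?_ (noX_dagWeights_litY j false) (fun l' hl' => by simp)
  exact xspec_seriesW (xspec_leafW_X l) (xspec_of_noX (noX_leafW _ (by simp)) fun _ => 0)
    (fun l' hl' => by simp) (fun l' => by simp) (fun l' hl' => rfl) (fun l' hl' => by simp at hl')

end ExprX

section ExprXFin

variable {k : Type u} [CommRing k] {κ : ℕ}

/-- In the DAG of `∏_{l<d} (X_l Y_l + 1 - Y_l)` the `X`-edges are `10 l + 2 → 10 l + 3` labelled
`X_l`, `l < d` (each factor has `2·5 + 2 = 12` vertices, glued in series). [cite: HrubesJoglekar2025, Thm. 3 (pp. 4–5)] -/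
theorem xspec_dagWeights_prodXY : ∀ (d : ℕ) (hd : d ≤ κ),
    XSpec (prodXY (k := k) d hd).dagWeights {l | l.val < d} (fun l => 10 * l.val + 2)
  | 0, _ => by
    intro a b l
    simp only [prodXY, ArithExpr.dagWeights, Set.mem_setOf_eq, Nat.not_lt_zero, false_and,
      iff_false]
    exact noX_leafW _ (by simp) a b l
  | d + 1, hd => by
    simp only [prodXY, ArithExpr.dagWeights]
    refine xspec_seriesW (xspec_dagWeights_prodXY d _) (xspec_dagWeights_factorXY _ _)
      (fun l hl => ?_) (fun l => ?_) (fun l hl => rfl) (fun l hl => ?_)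
    · simp only [Set.mem_setOf_eq] at hl
      rw [size_prodXY]
      omega
    · simp only [Set.mem_setOf_eq, Set.mem_singleton_iff, Fin.ext_iff]
      omega
    · simp only [Set.mem_singleton_iff] at hl
      subst hl
      rw [size_prodXY]
      ring

/-- The source vertex `10 l + 2 + (2 E(f̂) + 2)` of the `X_l`-edge in the DAG of `rookExpr`. [cite: HrubesJoglekar2025, Thm. 3 (pp. 4–5)] -/
def rookPos (κ : ℕ) (l : Fin κ) : ℕ := 10 * l.val + 2 + (2 * (5 * (2 ^ κ - 1)) + 2)

/-- Distinct variables sit on distinct edges. [cite: HrubesJoglekar2025, Thm. 3 (pp. 4–5)] -/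
theorem rookPos_injective (κ : ℕ) : Function.Injective (rookPos κ) := by
  intro l l' h
  simp only [rookPos] at h
  exact Fin.ext (by omega)

/-- The `X`-edges lie inside the DAG of `rookExpr`. [cite: HrubesJoglekar2025, Thm. 3 (pp. 4–5)] -/
theorem rookPos_lt (a : (Fin κ → Bool) → k) (l : Fin κ) : rookPos κ l + 1 < 2 * (rookExpr a).size + 2 := by
  rw [size_rookExpr, rookPos]
  have := l.isLt
  omega

/-- In the DAG of `rookExpr a` the `X`-edges are exactly `rookPos l → rookPos l + 1` labelled
`X_l`, for all `l`. [cite: HrubesJoglekar2025, Thm. 3 (pp. 4–5)] -/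
theorem xspec_dagWeights_rookExpr (a : (Fin κ → Bool) → k) :
    XSpec (rookExpr a).dagWeights Set.univ (rookPos κ) := by
  simp only [rookExpr, ArithExpr.dagWeights]
  refine xspec_seriesW (xspec_of_noX (noX_dagWeights_dtree κ le_rfl a) fun _ => 0)
    (xspec_dagWeights_prodXY κ le_rfl) (fun l hl => by simp at hl) (fun l => ?_)
    (fun l hl => by simp at hl) (fun l hl => ?_)
  · simp
  · rw [size_dtree, rookPos]

/-- **Where the `X`-variables sit in the matrix `μ(rookExpr a)`** of BCS 1997, Thm. (21.27):
`X_l` occurs exactly once, in the diagonal cell `(rookPos l, rookPos l)` (the edge `r → c + 1` is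
the cell `(r, c)` of the lower Hessenberg matrix) — in particular in pairwise distinct rows and
columns (Hrubeš–Joglekar 2025, Lemma 4: "every variable occurs in `M` the same number of times it
occurs in `F` … every column and row of `M` contains at most one variable", for the
`X`-variables of our formula). [cite: HrubesJoglekar2025, Lemma 4 (p. 4)] -/
theorem toMatrix_rookExpr_eq_X_iff (a : (Fin κ → Bool) → k) (r c : Fin (2 * (rookExpr a).size + 2))
    (l : Fin κ) : (rookExpr a).toMatrix r c = Sum.inr (Sum.inl l) ↔ (r = c ∧ r.val = rookPos κ l) := by
  simp only [ArithExpr.toMatrix]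
  split_ifs with h1 h2
  · simp only [false_iff, not_and]
    rintro rfl
    omega
  · rw [xspec_dagWeights_rookExpr a r.val (c.val + 1) l]
    simp only [Set.mem_univ, true_and, Fin.ext_iff]
    omega
  · simp only [false_iff, not_and]
    rintro rfl
    omega

end ExprXFin

section Rook

variable {k : Type u} {σ : Type v}

/-- `IsXRook emb A`: every `X`-variable `l : σ` (stored as the entry `Sum.inr (emb l)`) occurs in
the matrix `A` exactly once, and the `X`-cells have pairwise distinct rows and pairwise distinct
columns — the conclusion of Hrubeš–Joglekar 2025, Thm. 3 ("each variable `x_i` appears in `M`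
exactly once. Moreover, every row and column of `M` contains at most one variable") for the
`X`-variables, in a form invariant under re-indexing. [cite: HrubesJoglekar2025, Thm. 3 (pp. 4–5)] -/
def IsXRook {ι : Type*} {τ : Type*} (emb : σ → τ) (A : Matrix ι ι (k ⊕ τ)) : Prop :=
  (∀ l, ∃ r c, A r c = Sum.inr (emb l)) ∧
  ∀ r c r' c' l l', A r c = Sum.inr (emb l) → A r' c' = Sum.inr (emb l') →
    (r = r' ∨ c = c' ∨ l = l') → (r = r' ∧ c = c' ∧ l = l')

/-- Transfer of the rook property along an injective re-indexing `φ` of the `X`-cells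
(`B`'s `X`-cells are exactly the images of `A`'s). [cite: HrubesJoglekar2025, Thm. 3 (pp. 4–5)] -/
theorem IsXRook.transfer {ι ι' τ τ' : Type*} {emb : σ → τ} {emb' : σ → τ'} {A : Matrix ι ι (k ⊕ τ)}
    {B : Matrix ι' ι' (k ⊕ τ')} (φ : ι → ι') (hφ : Function.Injective φ)
    (hB : ∀ x y l, B x y = Sum.inr (emb' l) ↔ ∃ r c, x = φ r ∧ y = φ c ∧ A r c = Sum.inr (emb l))
    (hA : IsXRook emb A) : IsXRook emb' B := by
  refine ⟨fun l => ?_, fun x y x' y' l l' hx hx' hor => ?_⟩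
  · obtain ⟨r, c, h⟩ := hA.1 l
    exact ⟨φ r, φ c, (hB _ _ _).2 ⟨r, c, rfl, rfl, h⟩⟩
  · obtain ⟨r, c, rfl, rfl, h⟩ := (hB _ _ _).1 hx
    obtain ⟨r', c', rfl, rfl, h'⟩ := (hB _ _ _).1 hx'
    have key := hA.2 r c r' c' l l' h h' (by
      rcases hor with e | e | e
      · exact Or.inl (hφ e)
      · exact Or.inr (Or.inl (hφ e))
      · exact Or.inr (Or.inr e))
    exact ⟨by rw [key.1], by rw [key.2.1], key.2.2⟩

variable [CommRing k] {κ : ℕ}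

/-- The matrix `μ(rookExpr a)` of BCS Thm. (21.27) has the rook property for the `X`-variables
(Hrubeš–Joglekar 2025, Lemma 4 applied to the read-once formula `g`). [cite: HrubesJoglekar2025, Lemma 4 (p. 4)] -/
theorem isXRook_toMatrix_rookExpr (a : (Fin κ → Bool) → k) :
    IsXRook (Sum.inl : Fin κ → Fin κ ⊕ Fin κ) (rookExpr a).toMatrix := by
  refine ⟨fun l => ?_, fun r c r' c' l l' h h' hor => ?_⟩
  · refine ⟨⟨rookPos κ l, by have := rookPos_lt a l; omega⟩,
      ⟨rookPos κ l, by have := rookPos_lt a l; omega⟩, ?_⟩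
    rw [toMatrix_rookExpr_eq_X_iff]
    exact ⟨rfl, rfl⟩
  · rw [toMatrix_rookExpr_eq_X_iff] at h h'
    obtain ⟨rfl, hr⟩ := h
    obtain ⟨rfl, hr'⟩ := h'
    have : r = r' ↔ l = l' := by
      constructor
      · intro e; subst e; exact rookPos_injective κ (hr.symm.trans hr')
      · intro e; subst e; exact Fin.ext (hr.trans hr'.symm)
    rcases hor with e | e | e
    · exact ⟨e, e, this.1 e⟩
    · exact ⟨e, e, this.1 e⟩
    · exact ⟨this.2 e, this.2 e, e⟩

end Rook

section Elim

variable {k : Type u} {σ : Type v} {t N : ℕ}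

/-- `∃ r c, x = r ∧ y = c ∧ P r c ↔ P x y`. [folklore] -/
theorem exists_eq_eq_and_iff {α β : Type*} {x : α} {y : β} {P : α → β → Prop} :
    (∃ r c, x = r ∧ y = c ∧ P r c) ↔ P x y :=
  ⟨fun ⟨_, _, hr, hc, h⟩ => hr ▸ hc ▸ h, fun h => ⟨x, y, rfl, rfl, h⟩⟩

/-- Entrywise maps that preserve exactly the `X`-cells preserve the rook property. [cite: HrubesJoglekar2025, Thm. 3 (pp. 4–5)] -/
theorem IsXRook.map_of_iff {ι τ τ' : Type*} {emb : σ → τ} {emb' : σ → τ'} {A : Matrix ι ι (k ⊕ τ)}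
    (f : k ⊕ τ → k ⊕ τ') (hf : ∀ x l, f x = Sum.inr (emb' l) ↔ x = Sum.inr (emb l))
    (hA : IsXRook emb A) : IsXRook emb' (A.map f) :=
  hA.transfer id Function.injective_id fun x y l => by
    simp only [id_eq]
    rw [exists_eq_eq_and_iff, Matrix.map_apply, hf]

/-- Re-indexing rows and columns by one equivalence preserves the rook property. [cite: HrubesJoglekar2025, Thm. 3 (pp. 4–5)] -/
theorem IsXRook.submatrix {ι ι' τ : Type*} {emb : σ → τ} {A : Matrix ι ι (k ⊕ τ)} (e : ι' ≃ ι)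
    (hA : IsXRook emb A) : IsXRook emb (A.submatrix e e) :=
  hA.transfer e.symm e.symm.injective fun x y l => by
    simp only [Matrix.submatrix_apply]
    constructor
    · intro h; exact ⟨e x, e y, by simp, by simp, h⟩
    · rintro ⟨r, c, rfl, rfl, h⟩; simpa using h

/-- Substituting a constant for `Y₀` keeps exactly the `X`-entries. [cite: BurgisserClausenShokrollahi1997, Thm. (21.29)] -/
theorem substFirst_eq_X_iff (b : k) (x : k ⊕ (σ ⊕ Fin (t + 1))) (l : σ) :
    (substFirst b x : k ⊕ (σ ⊕ Fin t)) = Sum.inr (Sum.inl l) ↔ x = Sum.inr (Sum.inl l) := by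
  rcases x with c | i | jj
  · simp [substFirst]
  · simp [substFirst]
  · cases jj using Fin.cases with
    | zero => simp [substFirst]
    | succ j' => simp [substFirst]

/-- A Boolean substitution of the `Y`-block keeps exactly the `X`-entries. [cite: BurgisserClausenShokrollahi1997, Thm. (21.29)] -/
theorem boolSubstEntry_eq_X_iff [CommRing k] (e : Fin t → Bool) (x : k ⊕ (σ ⊕ Fin t)) (l : σ) :
    boolSubstEntry e x = Sum.inr l ↔ x = Sum.inr (Sum.inl l) := by
  rcases x with c | i | jj <;> simp [boolSubstEntry]

/-- Scaling a constant row preserves the rook property. [cite: BurgisserClausenShokrollahi1997, Thm. (21.29)] -/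
theorem IsXRook.scaleRow [CommRing k] {τ : Type*} {emb : σ → τ} (A : Matrix (Fin N) (Fin N) (k ⊕ τ))
    (r₀ : Fin N) (hr : ∀ s, (A r₀ s).isLeft = true) (a : k) (hA : IsXRook emb A) :
    IsXRook emb (scaleRow A r₀ a) := by
  refine hA.transfer id Function.injective_id fun x y l => ?_
  simp only [id_eq]
  rw [exists_eq_eq_and_iff, scaleRow_apply]
  split_ifs with h
  · subst h
    cases hx : A x y with
    | inl c => simp
    | inr v => have := hr y; rw [hx] at this; exact absurd this (by simp)
  · exact Iff.rfl

/-- Adjoining a `1 × 1` unit block preserves the rook property. [cite: BurgisserClausenShokrollahi1997, Thm. (21.29)] -/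
theorem IsXRook.extendOne [Field k] {τ : Type*} {emb : σ → τ} (A : Matrix (Fin N) (Fin N) (k ⊕ τ))
    (hA : IsXRook emb A) : IsXRook emb (extendOne A) := by
  unfold Literature.Computability.AlgebraicComplexity.extendOne
  refine IsXRook.submatrix _ (hA.transfer Sum.inl Sum.inl_injective fun x y l => ?_)
  rcases x with r | u <;> rcases y with c | u'
  · simp
  · simp
  · simp
  · simp

open GIdx in
/-- **The Valiant gadget of BCS Thm. (21.29) keeps the `X`-cells**: under the column property the
duplicated columns `R_{j4}` (copies of the `Y₀`-columns `s_j` of `A(Y₀:=1)`) contain no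
`X`-variable, so the `X`-cells of `A'` are exactly those of the original block (Hrubeš–Joglekar
2025, Lemma 5: "every variable `x_i` occurs in `M'` the same number of times it occurs in `M` …
every row and column of `M'` contains at most one variable"). [cite: HrubesJoglekar2025, Lemma 5 (pp. 4–5)] -/
theorem IsXRook.gadget [CommRing k] (A : Matrix (Fin N) (Fin N) (k ⊕ (σ ⊕ Fin (t + 1))))
    (hA : HasColumnProperty A) (ε : k) (h : IsXRook Sum.inl A) :
    IsXRook (Sum.inl : σ → σ ⊕ Fin t) (gadget A ε) := by
  refine h.transfer o (fun r r' e => by simpa using e) fun x y l => ?_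
  constructor
  · intro hx
    rcases x with r | ⟨⟨j', p' | p'⟩⟩ | ⟨⟨⟩⟩
    · rcases y with s | ⟨⟨j'', p'' | p''⟩⟩ | ⟨⟨⟩⟩
      · exact ⟨r, s, rfl, rfl, (substFirst_eq_X_iff _ _ _).1 (by simpa using hx)⟩
      · simp at hx
      · simp only [gadget_o_R] at hx
        split_ifs at hx with hp
        · exfalso
          have h1 := (substFirst_eq_X_iff _ _ _).1 hx
          have h2 := eq_Y0_of_mem_yCols A hA (yCol_mem A j'') (r := r) (by rw [h1]; rfl)
          rw [h1] at h2
          simp at h2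
      · simp at hx
    · exfalso
      rcases y with s | ⟨⟨j'', p'' | p''⟩⟩ | ⟨⟨⟩⟩
      · simp at hx
      · simp only [gadget_L_L] at hx; split_ifs at hx
      · simp only [gadget_L_R] at hx; split_ifs at hx
      · simp only [gadget_L_c] at hx; split_ifs at hx
    · exfalso
      rcases y with s | ⟨⟨j'', p'' | p''⟩⟩ | ⟨⟨⟩⟩
      · simp only [gadget_R_o] at hx; split_ifs at hx
      · simp only [gadget_R_L] at hx; split_ifs at hx
      · simp only [gadget_R_R] at hx; split_ifs at hx
      · simp at hx
    · exfalso
      have h1 := gadget_c_isLeft A ε y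
      rw [hx] at h1
      exact Bool.false_ne_true h1
  · rintro ⟨r, s, rfl, rfl, hrs⟩
    rw [gadget_o_o, substFirst_eq_X_iff]
    exact hrs

/-- The `Fin`-indexed gadget keeps the rook property. [cite: HrubesJoglekar2025, Lemma 5 (pp. 4–5)] -/
theorem IsXRook.gadgetFin [CommRing k] (A : Matrix (Fin N) (Fin N) (k ⊕ (σ ⊕ Fin (t + 1))))
    (hA : HasColumnProperty A) (ε : k) (h : IsXRook Sum.inl A) :
    IsXRook (Sum.inl : σ → σ ⊕ Fin t) (gadgetFin A ε) :=
  (h.gadget A hA ε).submatrix _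

variable [Field k]

/-- **Elimination of the Boolean variables keeping the `X`-cells read-once in distinct rows and
columns** (Hrubeš–Joglekar 2025, Lemma 5 = BCS 1997, Thm. (21.29) with the occurrence clause): the
induction `elim_boolSum` of `PermanentBooleanSum.lean`, one `Y`-variable at a time, carrying the
invariant `IsXRook`; size `N' ≤ N + 9·occ`. [cite: HrubesJoglekar2025, Lemma 5 (pp. 4–5)] -/
theorem elim_boolSum_rook (h2 : (2 : k) ≠ 0) (t : ℕ) :
    ∀ {N : ℕ} (A : Matrix (Fin N) (Fin N) (k ⊕ (σ ⊕ Fin t))),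
    HasColumnProperty A → HasConstRow A → IsXRook Sum.inl A →
    ∃ N', N' ≤ N + 9 * yOcc A ∧ ∃ A' : Matrix (Fin N') (Fin N') (k ⊕ σ),
      IsXRook id A' ∧ entryPer A' = ∑ e : Fin t → Bool, entryPer (boolSubst A e) := by
  induction t with
  | zero =>
    intro N A _ _ hX
    refine ⟨N, by omega, boolSubst A default, ?_, ?_⟩
    · exact hX.map_of_iff _ (fun x l => boolSubstEntry_eq_X_iff _ x l)
    · rw [Fintype.sum_unique]
      exact congrArg _ (congrArg _ (Subsingleton.elim _ _))
  | succ t ih =>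
    intro N A hA hrow hX
    by_cases hμ : yMult A = 0
    · -- `Y₀` does not occur: double, using the constant row
      obtain ⟨r₀, hr₀⟩ := hrow
      have h01 : A.map (substFirst (1 : k)) = A.map (substFirst 0) := by
        ext r s
        simp only [Matrix.map_apply]
        apply substFirst_eq_of_ne
        intro h
        have hs : s ∈ yCols A := (mem_yCols_iff A s).2 ⟨r, h⟩
        unfold yMult at hμ
        rw [Finset.card_eq_zero.1 hμ] at hs
        simp at hs
      have hr₀' : ∀ s, ((A.map (substFirst (0 : k))) r₀ s).isLeft = true := by
        intro s
        simp only [Matrix.map_apply]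
        cases hx : A r₀ s with
        | inl c => rfl
        | inr v => have := hr₀ s; rw [hx] at this; exact absurd this (by simp)
      have hcol : HasColumnProperty (A.map (substFirst (0 : k))) := by
        intro j i i' hi hi'
        exact hA j i i' (isRight_substFirst hi) (isRight_substFirst hi')
      have hX0 : IsXRook (Sum.inl : σ → σ ⊕ Fin t) (A.map (substFirst (0 : k))) :=
        hX.map_of_iff _ (fun x l => substFirst_eq_X_iff _ x l)
      obtain ⟨N', hN', A', hA'X, hA'⟩ := ih (scaleRow (A.map (substFirst 0)) r₀ 2)
        (hasColumnProperty_scaleRow _ hcol r₀ 2) ⟨r₀, fun s => by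
          rw [scaleRow_apply, if_pos rfl]
          cases hx : (A.map (substFirst (0 : k))) r₀ s with
          | inl c => rfl
          | inr v => have := hr₀' s; rw [hx] at this; exact absurd this (by simp)⟩
        (hX0.scaleRow _ r₀ hr₀' 2)
      refine ⟨N', ?_, A', hA'X, ?_⟩
      · rw [yOcc_scaleRow _ r₀ hr₀'] at hN'
        have h1 : yOcc (A.map (substFirst (0 : k))) = ySuccOcc A := by
          classical
          unfold yOcc ySuccOcc
          congr 1
          ext ⟨r, s⟩
          simp only [Finset.mem_filter, Finset.mem_univ, true_and, Matrix.map_apply,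
            substFirst_eq_Y_iff]
        rw [h1] at hN'
        have h3 := yOcc_eq_yMult_add A hA
        omega
      · rw [hA', sum_entryPer_boolSubst_succ, h01]
        refine Finset.sum_congr rfl fun e _ => ?_
        rw [entryPer_boolSubst_scaleRow _ r₀ hr₀', show (C 2 : MvPolynomial σ k) = 2 from map_ofNat C 2,
          two_mul]
    · -- the gadget
      have hμ' : 0 < yMult A := Nat.pos_of_ne_zero hμ
      have h16 : (16 : k) ^ yMult A ≠ 0 := by
        apply pow_ne_zero
        have : (16 : k) = 2 ^ 4 := by norm_num
        rw [this]
        exact pow_ne_zero _ h2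
      set ε : k := ((16 : k) ^ yMult A)⁻¹ with hε
      obtain ⟨N', hN', A', hA'X, hA'⟩ := ih (gadgetFin A ε) (hasColumnProperty_gadgetFin A ε hA)
        (hasConstRow_gadgetFin A ε) (hX.gadgetFin A hA ε)
      refine ⟨N', ?_, A', hA'X, ?_⟩
      · rw [yOcc_gadgetFin A ε hA] at hN'
        have h3 := yOcc_eq_yMult_add A hA
        omega
      · rw [hA', sum_entryPer_boolSubst_succ]
        refine Finset.sum_congr rfl fun e _ => ?_
        rw [entryPer_boolSubst, entryPer_gadgetFin, permanent_gadgetM A ε hμ', hε,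
          inv_mul_cancel₀ h16, C_1, one_mul, map_add, ← entryPer_boolSubst, ← entryPer_boolSubst]

/-- **Hrubeš–Joglekar 2025, Theorem 3** (read-once universality of the permanent, with sizes): over
a field of characteristic `≠ 2`, every multilinear polynomial `∑_e a_e ∏_{e_l=1} X_l` in `κ`
variables is `per(B)` for a matrix `B` over `k ∪ X` of size `≤ 256 · 2^κ` in which every `X_l`
occurs exactly once and the `X`-cells lie in pairwise distinct rows and columns. Proof as printed:
`g = f̂(Y) ∏ (X_l Y_l + 1 - Y_l)` (`rookExpr`), Lemma 4 (`ArithExpr.toMatrix`, BCS (21.27)) and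
Lemma 5 (`elim_boolSum_rook`, BCS (21.29)); the constant `256` absorbs `10 · (2 E(g) + 3)`. [cite: HrubesJoglekar2025, Thm. 3 (pp. 4–5)] -/
theorem exists_isXRook_entryPer (hk : ringChar k ≠ 2) (κ : ℕ) (a : (Fin κ → Bool) → k) :
    ∃ N, N ≤ 256 * 2 ^ κ ∧ ∃ B : Matrix (Fin N) (Fin N) (k ⊕ Fin κ), IsXRook id B ∧
      entryPer B = ∑ e : Fin κ → Bool, C (a e) * ∏ i : Fin κ, if e i then X i else 1 := by
  have h2 := two_ne_zero_of_ringChar_ne_two hk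
  set A₀ := (rookExpr a).toMatrix with hA₀
  obtain ⟨N', hN', B, hBX, hB⟩ := elim_boolSum_rook h2 κ (extendOne A₀)
    (hasColumnProperty_extendOne A₀ (rookExpr a).hasColumnProperty_toMatrix) (hasConstRow_extendOne A₀)
    ((isXRook_toMatrix_rookExpr a).extendOne A₀)
  refine ⟨N', ?_, B, hBX, ?_⟩
  · rw [yOcc_extendOne] at hN'
    have h1 := yOcc_le A₀ (rookExpr a).hasColumnProperty_toMatrix
    have h3 := size_rookExpr a
    have h4 := Nat.one_le_two_pow (n := κ)
    have h5 : κ ≤ 2 ^ κ := (Nat.lt_two_pow_self).le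
    have : 2 * (rookExpr a).size + 2 ≤ 10 * 2 ^ κ + 10 * κ := by omega
    omega
  · rw [hB, ← boolSum_rookExpr, ← ArithExpr.entryPer_toMatrix, boolSum_entryPer]
    exact Finset.sum_congr rfl fun e _ => entryPer_boolSubst_extendOne A₀ e

end Elim

section Pad

variable {k : Type u} [Field k] {κ : ℕ}

/-- **Hrubeš–Joglekar 2025, Theorem 3 in the form used in the proof of Theorem 7** (with footnote 3,
"perm_n is invariant under permutations of rows and columns", and the padding by an identity block
built in): over a field of characteristic `≠ 2`, for `n ≥ 256 · 2^κ` and any `κ` cells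
`(ρr l, ρc l)` in pairwise distinct rows and pairwise distinct columns of an `n × n` matrix, every
multilinear polynomial in `X_0, …, X_{κ-1}` is the permanent of a symbolic `n × n` matrix `S`
over `X ∪ k` carrying `X_l` exactly in the cell `(ρr l, ρc l)` and constants in all other cells —
"for every multilinear `f ∈ 𝔽[Z]` there is a matrix `X̄_f` obtained by setting variables outside
of `Z` to constants in `X̄` such that `f = perm_n(X̄_f)`". [cite: HrubesJoglekar2025, proof of Thm. 7 (p. 6)] -/
theorem exists_rook_symbMatrix (hk : ringChar k ≠ 2) {n : ℕ} (hn : 256 * 2 ^ κ ≤ n)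
    (ρr ρc : Fin κ → Fin n) (hρr : Function.Injective ρr) (hρc : Function.Injective ρc)
    (a : (Fin κ → Bool) → k) :
    ∃ S : Matrix (Fin n) (Fin n) (Fin κ ⊕ k),
      (∀ i j l, S i j = Sum.inl l ↔ (i = ρr l ∧ j = ρc l)) ∧
      (symbPoly S).permanent = ∑ e : Fin κ → Bool, C (a e) * ∏ i : Fin κ, if e i then X i else 1 := by
  obtain ⟨N, hN, B, hBX, hB⟩ := exists_isXRook_entryPer hk κ a
  have hNn : N ≤ n := hN.trans hn
  -- padding with an identity block
  set P : Matrix (Fin N ⊕ Fin (n - N)) (Fin N ⊕ Fin (n - N)) (k ⊕ Fin κ) :=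
    Matrix.fromBlocks B (fun _ _ => Sum.inl 0) (fun _ _ => Sum.inl 0)
      (fun i j => if i = j then Sum.inl 1 else Sum.inl 0) with hPdef
  set e₀ : Fin n ≃ Fin N ⊕ Fin (n - N) :=
    (finCongr (by omega : n = N + (n - N))).trans finSumFinEquiv.symm with he₀
  set B₂ : Matrix (Fin n) (Fin n) (k ⊕ Fin κ) := P.submatrix e₀ e₀ with hB₂def
  have hP : IsXRook id P := by
    refine hBX.transfer Sum.inl Sum.inl_injective fun x y l => ?_
    rcases x with r | u <;> rcases y with c | u'
    · simp [hPdef]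
    · simp [hPdef]
    · simp [hPdef]
    · simp only [hPdef, Matrix.fromBlocks_apply₂₂, id_eq, reduceCtorEq, false_and,
        exists_false, iff_false]
      split_ifs <;> simp
  have hB₂ : IsXRook id B₂ := hP.submatrix e₀
  have hperB₂ : (B₂.map entryVal).permanent = (B.map entryVal : Matrix _ _ (MvPolynomial (Fin κ) k)).permanent := by
    have h1 : (P.map entryVal : Matrix _ _ (MvPolynomial (Fin κ) k)) =
        Matrix.fromBlocks (B.map entryVal) 0 0 1 := by
      ext (i | i) (j | j)
      · rfl
      · simp [hPdef]
      · simp [hPdef]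
      · simp only [hPdef, Matrix.map_apply, Matrix.fromBlocks_apply₂₂, Matrix.one_apply]
        split_ifs <;> simp
    rw [hB₂def, ← Matrix.submatrix_map, Matrix.permanent_submatrix_equiv, h1,
      Matrix.permanent_fromBlocks_zero₂₁, Matrix.permanent_one, mul_one]
  -- the rook cells of `B₂`
  choose rw cl hrc using hB₂.1
  have hrw : Function.Injective rw := fun l l' h =>
    (hB₂.2 _ _ _ _ _ _ (hrc l) (hrc l') (Or.inl h)).2.2
  have hcl : Function.Injective cl := fun l l' h =>
    (hB₂.2 _ _ _ _ _ _ (hrc l) (hrc l') (Or.inr (Or.inl h))).2.2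
  obtain ⟨πr, hπr⟩ := Equiv.Perm.exists_extending_pair rw ρr hrw hρr
  obtain ⟨πc, hπc⟩ := Equiv.Perm.exists_extending_pair cl ρc hcl hρc
  refine ⟨fun i j => (B₂ (πr.symm i) (πc.symm j)).swap, fun i j l => ?_, ?_⟩
  · change (B₂ (πr.symm i) (πc.symm j)).swap = Sum.inl l ↔ _
    have hsw : ∀ x : k ⊕ Fin κ, x.swap = Sum.inl l ↔ x = Sum.inr l := by
      rintro (x | x) <;> simp
    rw [hsw]
    constructor
    · intro h
      have key := hB₂.2 _ _ _ _ _ _ h (hrc l) (Or.inr (Or.inr rfl))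
      constructor
      · rw [← hπr l, ← key.1, Equiv.apply_symm_apply]
      · rw [← hπc l, ← key.2.1, Equiv.apply_symm_apply]
    · rintro ⟨rfl, rfl⟩
      rw [← hπr l, ← hπc l, Equiv.symm_apply_apply, Equiv.symm_apply_apply]
      exact hrc l
  · have h1 : symbPoly (fun i j => (B₂ (πr.symm i) (πc.symm j)).swap) =
        ((B₂.map entryVal).submatrix πr.symm id).submatrix id πc.symm := by
      ext i j
      simp only [symbPoly, Matrix.map_apply, Matrix.submatrix_apply, id_eq]
      cases B₂ (πr.symm i) (πc.symm j) <;> simp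
    rw [h1, Matrix.permanent_permute_rows, Matrix.permanent_permute_cols, hperB₂]
    exact hB

end Pad

end Literature.Computability.AlgebraicComplexity
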